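import Mathlib
import HarnessLib
import Literature.AlgebraicGeometry.Ramification.InertiaNormalSylow
import Literature.RingTheory.CompleteLocalRings.TameAutomorphismCotangent
import Summits.ResolutionOfSingularities.ResolutionOfSingularities.Theorems.WildQuotientsWildQuotientResolutionStubFlagCore
import Summits.ResolutionOfSingularities.ResolutionOfSingularities.Theorems.WildQuotientsWildQuotientResolutionFlagKernels

/-!
# The toroidal END STATE of Phase 0 is p-closed: stable boundary divisors + tame elements trivial on the residual cotangent space
# (crux `WildQuotients.WildQuotientResolution`, stub `stub_phaseZeroHighDim`; any embedding dimension)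

Crux stmt-ResolutionOfSingularities-15640 (`WildQuotientResolution`), registered stub `stub_phaseZeroHighDim`
(Phase 0 for `dim X′ ≥ 3`: a `G`-equivariant proper birational REGULAR model on which every inertia group is
p-closed). With ✓`TameFixedLocus` (p817669: the fixed loci of the TAME subgroups of an inertia group are
permissible centres in every dimension) the all-dimensional Phase-0 design is a tame toroidalisation: blow up
tame carrier centres, `G`-equivariantly, until at every point `x` the inertia group `I = I_x` (i) stabilises each
of the boundary (exceptional) divisors `E₁, …, E_r` through `x`, and (ii) its elements of order prime to `p` act
TRIVIALLY on the cotangent space `𝔪/𝔪²` modulo the conormal lines of the `Eᵢ`. This file proves that such an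
end state is p-closed — the local criterion the procedure aims at, in arbitrary embedding dimension:

**Theorem** (`hasNormalSylow_of_tame_trivial_mod_boundary`). Let `(R, 𝔪, κ)` be a Noetherian local ring of
residue characteristic `p`, `τ : I →* (R ≃+* R)` a faithful residue-trivial action of a finite group, and
`z₁, …, z_r ∈ 𝔪` (local equations of the boundary divisors through the point; NO independence is needed)
such that `τ g (zᵢ) ∈ (zᵢ) + 𝔪²` for all `g`, `i` (each divisor is `I`-stable to first order) and
`τ g x − x ∈ (z₁, …, z_r) + 𝔪²` for all `x ∈ 𝔪` whenever the order of `g` is prime to `p` (tame elements act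
trivially on `𝔪 / ((z) + 𝔪²)`). Then `I` has a normal Sylow `p`-subgroup.

Proof: the `τ`-stable flag `𝔪² ⊆ (z₁) + 𝔪² ⊆ (z₁, z₂) + 𝔪² ⊆ ⋯ ⊆ (z) + 𝔪² ⊆ 𝔪` has LINE pieces, on which
`I` acts through characters `I → κˣ` (✓`FlagCore.exists_character_of_line`), so the piece kernels have
COMMUTATIVE quotients; and a top piece `𝔪 / ((z) + 𝔪²)` whose kernel contains every element of order prime to
`p`, so its quotient is a `p`-GROUP (`g ↦ g ^ (p ^ v_p(ord g))` lands in the kernel). Both kinds are p-closed,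
and ✓`FlagKernels.hasNormalSylow_of_stable_flag` (hand 4: unipotent kernel of level `r + 1`,
✓`UnipotentLevel`, + p-closed piece quotients) concludes.

[OURS · crux stmt-ResolutionOfSingularities-15640 · helper toward `stub_phaseZeroHighDim` (the local END-STATE
criterion of the tame toroidalisation; NOT a proof of the stub); folklore group theory / local algebra,
counted 0; AI-level work, weaker than expert review.] [folklore]

* `hasNormalSylow_quotient_of_comm_character` — a normal subgroup containing the kernel of a character has a
  commutative, hence p-closed, quotient;
* `isPGroup_quotient_of_forall_coprime_mem`, `hasNormalSylow_quotient_of_forall_coprime_mem` — a normal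
  subgroup containing every element of order prime to `p` has a `p`-group quotient;
* `apply_mem_maximalIdeal_of_res`, `apply_mem_sq_of_res` — residue-trivial automorphisms preserve `𝔪`, `𝔪²`;
* `hasNormalSylow_of_tame_trivial_mod_boundary` — the theorem.
-/

-- single-problem summit: the doubled namespace component `ResolutionOfSingularities` is forced
set_option linter.dupNamespace false

open IsLocalRing Literature.AlgebraicGeometry.Ramification Literature.RingTheory.CompleteLocalRings
open Summit.ResolutionOfSingularities.ResolutionOfSingularities.Theorems.WildQuotientResolution.FlagCore
open Summit.ResolutionOfSingularities.ResolutionOfSingularities.Theorems.WildQuotientResolution.FlagKernels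

namespace Summit.ResolutionOfSingularities.ResolutionOfSingularities.Theorems.WildQuotientResolution.TameEndState

/-! ## Group theory of the two kinds of pieces -/

section Group

variable {I : Type*} [Group I]

/-- **Line pieces**: if a normal subgroup `M` contains the kernel of a homomorphism `ν` to a commutative
group (a character `I → κˣ`), then `I ⧸ M` is commutative, so each of its Sylow `p`-subgroups is normal.
[folklore] -/
theorem hasNormalSylow_quotient_of_comm_character {p : ℕ} {C : Type*} [CommGroup C] (ν : I →* C)
    (M : Subgroup I) [M.Normal] (hM : ∀ g, ν g = 1 → g ∈ M) : HasNormalSylow p (I ⧸ M) := by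
  have hcomm : ∀ a b : I ⧸ M, a * b = b * a := by
    intro a b
    obtain ⟨x, rfl⟩ := QuotientGroup.mk_surjective a
    obtain ⟨y, rfl⟩ := QuotientGroup.mk_surjective b
    rw [← QuotientGroup.mk_mul, ← QuotientGroup.mk_mul, QuotientGroup.eq]
    refine hM _ ?_
    rw [map_mul, map_inv, map_mul, map_mul, mul_comm (ν y) (ν x), inv_mul_cancel]
  refine ⟨Classical.arbitrary _, ⟨fun n hn g => ?_⟩⟩
  rw [hcomm g n, mul_inv_cancel_right]
  exact hn

/-- **Top piece**: if a normal subgroup `M` of a finite group contains every element of order prime to the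
prime `p`, then `I ⧸ M` is a `p`-group (`g ^ (p ^ v_p(ord g))` has order prime to `p`). [folklore] -/
theorem isPGroup_quotient_of_forall_coprime_mem {p : ℕ} [hp : Fact p.Prime] [Finite I]
    (M : Subgroup I) [M.Normal] (hM : ∀ g : I, (orderOf g).Coprime p → g ∈ M) :
    IsPGroup p (I ⧸ M) := by
  intro a
  obtain ⟨g, rfl⟩ := QuotientGroup.mk_surjective a
  refine ⟨(orderOf g).factorization p, ?_⟩
  rw [← QuotientGroup.mk_pow, QuotientGroup.eq_one_iff]
  apply hM
  have hn : orderOf g ≠ 0 := (orderOf_pos g).ne'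
  rw [orderOf_pow' g (pow_ne_zero _ hp.out.ne_zero),
    Nat.gcd_eq_right (Nat.ordProj_dvd (orderOf g) p)]
  exact (Nat.coprime_ordCompl hp.out hn).symm

/-- Hence such a quotient is p-closed. [folklore] -/
theorem hasNormalSylow_quotient_of_forall_coprime_mem {p : ℕ} [Fact p.Prime] [Finite I]
    (M : Subgroup I) [M.Normal] (hM : ∀ g : I, (orderOf g).Coprime p → g ∈ M) :
    HasNormalSylow p (I ⧸ M) :=
  HasNormalSylow.of_isPGroup (isPGroup_quotient_of_forall_coprime_mem M hM)

end Group

/-! ## The end-state criterion -/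

section LocalRing

variable {R : Type*} [CommRing R] [IsLocalRing R] {I : Type*} [Group I]

/-- A residue-trivial automorphism maps `𝔪` into `𝔪`. [folklore] -/
theorem apply_mem_maximalIdeal_of_res {τ : I →* (R ≃+* R)}
    (hres : ∀ (g : I) (r : R), τ g r - r ∈ maximalIdeal R) (g : I) {x : R}
    (hx : x ∈ maximalIdeal R) : τ g x ∈ maximalIdeal R := by
  have e : τ g x = x + (τ g x - x) := by ring
  rw [e]
  exact add_mem hx (hres g x)

omit [IsLocalRing R] in
/-- A ring automorphism of a local ring maps `𝔪²` into `𝔪²`. [folklore] -/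
theorem apply_mem_sq_of_res [IsLocalRing R] (τ : I →* (R ≃+* R)) (g : I) {x : R}
    (hx : x ∈ maximalIdeal R ^ 2) : τ g x ∈ maximalIdeal R ^ 2 :=
  map_maximalIdeal_pow_le (τ g) 2 (Ideal.mem_map_of_mem _ hx)

/-- **The toroidal end state is p-closed** (crux stmt-ResolutionOfSingularities-15640, toward
`stub_phaseZeroHighDim`; any embedding dimension). Let `(R, 𝔪, κ)` be a Noetherian local ring of residue
characteristic `p`, `τ` a faithful residue-trivial action of the finite group `I` on `R`, and
`z : Fin r → 𝔪` local equations of boundary divisors through the point, each `I`-stable to first order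
(`τ g (z i) ∈ (z i) + 𝔪²`). If every element of `I` of order prime to `p` acts trivially on
`𝔪 / ((z₁, …, z_r) + 𝔪²)` (`τ g x − x ∈ (z) + 𝔪²` for `x ∈ 𝔪`), then `I` has a normal Sylow `p`-subgroup.
(Flag `𝔪² ⊆ (z₁) + 𝔪² ⊆ ⋯ ⊆ (z) + 𝔪² ⊆ 𝔪`: line pieces with commutative piece quotients, top piece with
a `p`-group quotient; ✓`FlagKernels.hasNormalSylow_of_stable_flag`.) [folklore] -/
theorem hasNormalSylow_of_tame_trivial_mod_boundary (p : ℕ) [Fact p.Prime] [IsNoetherianRing R]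
    [CharP (ResidueField R) p] [Finite I] {τ : I →* (R ≃+* R)} (hτ : Function.Injective τ)
    (hres : ∀ (g : I) (r : R), τ g r - r ∈ maximalIdeal R)
    {r : ℕ} (z : Fin r → R) (hz : ∀ i, z i ∈ maximalIdeal R)
    (hstab : ∀ (g : I) (i : Fin r), τ g (z i) ∈ Ideal.span {z i} ⊔ maximalIdeal R ^ 2)
    (htame : ∀ g : I, (orderOf g).Coprime p → ∀ x ∈ maximalIdeal R,
      τ g x - x ∈ Ideal.span (Set.range z) ⊔ maximalIdeal R ^ 2) :
    HasNormalSylow p I := by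
  classical
  set m := maximalIdeal R with hmdef
  -- the partial boundary sets and the flag
  let S : ℕ → Set R := fun i => {x | ∃ j : Fin r, (j : ℕ) < i ∧ z j = x}
  let K : ℕ → Ideal R := fun i => if i ≤ r then Ideal.span (S i) ⊔ m ^ 2 else m
  have hK_le : ∀ {i}, i ≤ r → K i = Ideal.span (S i) ⊔ m ^ 2 := fun {i} hi => if_pos hi
  have hK_gt : ∀ {i}, ¬ i ≤ r → K i = m := fun {i} hi => if_neg hi
  have hSm : ∀ i, S i ⊆ m := by
    rintro i _ ⟨j, -, rfl⟩
    exact hz j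
  have hm2 : m ^ 2 ≤ m := Ideal.pow_le_self two_ne_zero
  have hKm : ∀ i, K i ≤ m := by
    intro i
    by_cases hi : i ≤ r
    · rw [hK_le hi]
      exact sup_le (Ideal.span_le.mpr (hSm i)) hm2
    · rw [hK_gt hi]
  have hK2 : ∀ i, m ^ 2 ≤ K i := by
    intro i
    by_cases hi : i ≤ r
    · rw [hK_le hi]
      exact le_sup_right
    · rw [hK_gt hi]
      exact hm2
  have hK0 : K 0 ≤ m ^ 2 := by
    rw [hK_le (Nat.zero_le r)]
    refine sup_le (Ideal.span_le.mpr ?_) le_rfl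
    rintro _ ⟨j, hj, -⟩
    exact absurd hj (Nat.not_lt_zero _)
  have hKn : m ≤ K (r + 1) := by
    rw [hK_gt (by omega)]
  -- `τ`-stability of the flag
  have hspanτ : ∀ (g : I) (i : ℕ), i ≤ r → ∀ x ∈ Ideal.span (S i), τ g x ∈ K i := by
    intro g i hi x hx
    rw [hK_le hi]
    induction hx using Submodule.span_induction with
    | mem y hy =>
      obtain ⟨j, hj, rfl⟩ := hy
      have hle : Ideal.span {z j} ⊔ m ^ 2 ≤ Ideal.span (S i) ⊔ m ^ 2 :=
        sup_le_sup_right (Ideal.span_mono (Set.singleton_subset_iff.mpr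
          (show z j ∈ S i from ⟨j, hj, rfl⟩))) _
      exact hle (hstab g j)
    | zero => rw [map_zero]; exact zero_mem _
    | add x y _ _ hx hy => rw [map_add]; exact add_mem hx hy
    | smul a x _ hx => rw [smul_eq_mul, map_mul]; exact Ideal.mul_mem_left _ _ hx
  have hKτ : ∀ (g : I) (i : ℕ), ∀ x ∈ K i, τ g x ∈ K i := by
    intro g i x hx
    by_cases hi : i ≤ r
    · rw [hK_le hi] at hx
      obtain ⟨a, ha, b, hb, rfl⟩ := Submodule.mem_sup.mp hx
      rw [map_add]
      refine add_mem (hspanτ g i hi a ha) ?_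
      exact hK2 i (apply_mem_sq_of_res τ g hb)
    · rw [hK_gt hi] at hx ⊢
      exact apply_mem_maximalIdeal_of_res hres g hx
  -- the line pieces: `K (i+1) = (z i) + K i` for `i < r`
  have hline : ∀ (i : ℕ) (hi : i < r), ∀ x ∈ K (i + 1), ∃ a : R, x - a * z ⟨i, hi⟩ ∈ K i := by
    intro i hi x hx
    rw [hK_le (by omega : i + 1 ≤ r)] at hx
    obtain ⟨a', ha', b, hb, rfl⟩ := Submodule.mem_sup.mp hx
    have hS : S (i + 1) ⊆ insert (z ⟨i, hi⟩) (S i) := by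
      rintro _ ⟨j, hj, rfl⟩
      by_cases hji : (j : ℕ) < i
      · exact Set.mem_insert_of_mem _ ⟨j, hji, rfl⟩
      · have hje : j = ⟨i, hi⟩ := Fin.ext (by simp only; omega)
        rw [hje]
        exact Set.mem_insert _ _
    have ha'' : a' ∈ Ideal.span (insert (z ⟨i, hi⟩) (S i)) := Ideal.span_mono hS ha'
    rw [Ideal.span_insert] at ha''
    obtain ⟨c, hc, d, hd, rfl⟩ := Submodule.mem_sup.mp ha''
    obtain ⟨a, rfl⟩ := Ideal.mem_span_singleton'.mp hc
    refine ⟨a, ?_⟩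
    have e : a * z ⟨i, hi⟩ + d + b - a * z ⟨i, hi⟩ = d + b := by ring
    rw [e, hK_le (by omega : i ≤ r)]
    exact add_mem (Ideal.mem_sup_left hd) (Ideal.mem_sup_right hb)
  -- the top piece: `K r = (z) + 𝔪²`
  have hKr : K r = Ideal.span (Set.range z) ⊔ m ^ 2 := by
    rw [hK_le le_rfl]
    congr 2
    ext x
    constructor
    · rintro ⟨j, -, rfl⟩
      exact ⟨j, rfl⟩
    · rintro ⟨j, rfl⟩
      exact ⟨j, j.isLt, rfl⟩
  -- assemble
  refine hasNormalSylow_of_stable_flag p hτ hres (r + 1) K hK0 hKn hKτ fun i hi M _ hM => ?_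
  by_cases hir : i < r
  · -- line piece: character of the line `K (i+1) / K i`
    have hzi : z ⟨i, hir⟩ ∈ (K (i + 1) : Set R) := by
      show z ⟨i, hir⟩ ∈ K (i + 1)
      rw [hK_le (by omega : i + 1 ≤ r)]
      exact Ideal.mem_sup_left (Ideal.subset_span
        (show z ⟨i, hir⟩ ∈ S (i + 1) from ⟨⟨i, hir⟩, Nat.lt_succ_self i, rfl⟩))
    obtain ⟨ν, hν⟩ := exists_character_of_line τ hres (L := (K (i + 1) : Set R))
      (fun x hx => hKm _ hx) (fun g x hx => hKτ g _ x hx) (K i) (fun g x hx => hKτ g i x hx)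
      (hK2 i) hzi (hline i hir)
    exact hasNormalSylow_quotient_of_comm_character ν M fun g hg => (hM g).mpr (hν g hg)
  · -- top piece `i = r`
    have hieq : i = r := by omega
    subst hieq
    refine hasNormalSylow_quotient_of_forall_coprime_mem M fun g hg => (hM g).mpr fun x hx => ?_
    rw [hKr]
    rw [hK_gt (by omega)] at hx
    exact htame g hg x hx

end LocalRing

end Summit.ResolutionOfSingularities.ResolutionOfSingularities.Theorems.WildQuotientResolution.TameEndState
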